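import Summits.QuantumFields.YangMills.Theorems.BalabanUVNodesN15KingModelCurvatureFlux
import Mathlib.Analysis.SpecialFunctions.Complex.Arg
import HarnessLib

/-!
# BalabanUVNodes ∕ N15 — THE KING-MODEL RUNG (PART Ϳ-f): CURVATURE BOUNDED BELOW — INHOMOGENEOUS AND NON-ABELIAN READINGS of the plaquette mass: (i) a holonomy BOUNDED AWAY FROM `1`
# on every vector, `‖(P−1)u‖ ≥ s‖u‖` (any `U(n)`), has numerical range in `Re ≤ 1 − s²∕2` — so Ϳ-b gives the mass `2c·λ(1−s²∕2)` (`= 2c(2−2cos(θ₀∕4))` at `s = 2sin(θ₀∕2)`); (ii) a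
# `U(1)` field whose `(ν₀,ν₁)`-plaquette ANGLES satisfy `|arg P(x)| ≥ θ₀` at every site (NON-CONSTANT curvature) has mass `≥ 2c(2−2cos(θ₀∕4))`; (iii) the mass is monotone in the curvature bound
# (Track A, DAG node N15 = NE2; FAN-OUT v1.1 §N15 s3 «KING-MODEL RUNG … + what the curved case adds»; count-neutral)

HONEST FRAMING.  Count-neutral (cell `pub-ymgap`, seat `pub-ymgap-dag-n15-e` g46; `--supports stmt-QuantumFields-27247 --as helper` = K3ᴬ, KEY MAP v3).  King's fine covariance layer
`−cΔ_U+m²` (Ͱ-a `covLapF`) at unitary link fields on ONE finite torus; elementary; NOT Bałaban's `G_k(U)`; NOT [Balaban1985BackgroundPropagators] (3.42) (whose regime is the OPPOSITE one,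
plaquettes CLOSE to `1`); NOT a node discharge (N15 of record untouched); nothing continuum ∕ ℝ⁴ ∕ OS ∕ Clay.

THE RESULTS (`K` any period vector, `c ≥ 0`, any `m²`; `λ = plaqGap` of Ϳ-a, `P_U` = Ͻ-q `kingPlaq`):
* §1 (any inner product space) ★★ **`re_inner_le_of_sub_bounded_below`** — for a linear isometry `W` with `s‖u‖ ≤ ‖Wu − u‖` for all `u`: `Re⟪u, Wu⟫ ≤ (1 − s²∕2)‖u‖²` (polarisation:
  `‖Wu − u‖² = 2‖u‖² − 2Re⟪u,Wu⟫`); `one_sub_sq_half_eq_cos` (`1 − (2sin(θ∕2))²∕2 = cos θ`); so for a NORMAL (e.g. unitary) holonomy with all eigenvalues `e^{iθ_j}`, `|θ_j| ≥ θ₀`, the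
  hypothesis holds with `s = 2sin(θ₀∕2)` and `γ = cos θ₀` — the gauge-invariant, NON-ABELIAN form of «curvature bounded below» (the spectral statement itself is not needed and not proved);
* §2 ★★★ **`re_quadForm_covLapF_ge_of_holonomy_gap`** — any fibre `𝕜ⁿ`, unitary `U`, `ν₀ ≠ ν₁`: `(∀ x u, s‖u‖ ≤ ‖(P_U(x,ν₀,ν₁) − 1)u‖) ⟹ (m² + 2c·λ(1 − s²∕2))·Σ‖v_x‖² ≤ Re⟨v,(−cΔ_U+m²)v⟩`;
  ★★ `l2_opNorm_covLapF_inv_le_of_holonomy_gap`; `plaqGap_one_sub_sq_half_pos` (`0 < s ⟹ λ(1−s²∕2) > 0`): EVERY uniformly curved non-abelian field gives King's massless covariant Laplacian a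
  volume-independent mass;
* §3 (`U(1)`, `𝕜 = ℂ`, INHOMOGENEOUS flux) `re_le_cos_of_abs_arg_ge` (`|z| = 1`, `θ₀ ≤ |arg z|` ⟹ `Re z ≤ cos θ₀`), ★★★ **`re_quadForm_covLapF_ge_of_plaq_angle`** — `(∀ x, θ₀ ≤ |arg P_U(x,ν₀,ν₁)|)`,
  `0 ≤ θ₀ ≤ π` ⟹ `(m² + 2c(2−2cos(θ₀∕4)))·Σ|v_x|² ≤ Re⟨v,(−cΔ_U+m²)v⟩` — non-constant curvature of either sign, bounded below in modulus, suffices; ★★ `posDef_covLapF_massless_of_plaq_angle`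
  (`θ₀ > 0`, `c > 0`), ★★ `l2_opNorm_covLapF_inv_le_of_plaq_angle`;
* §4 `curvatureMass_mono` (`θ₀ ↦ 2−2cos(θ₀∕4)` is monotone on `[0,π]`: more curvature, more mass, up to the π-flux value `2−√2` of Ϳ-d), `curvatureMass_le_pi` .
WHAT THE CURVED CASE ADDS (as theorems): the plaquette mass of PART Ϳ needs only a LOWER BOUND ON THE MODULUS of the curvature, site by site, abelian or not, constant or not; it is monotone in
that bound and saturates at π-flux.  PRIOR TREE ART (by name, not restated): Ϳ-a (`plaqGap`, `plaqGap_cos`, `plaqGap_antitone`, `plaqGap_neg_one`), Ϳ-b (`re_quadForm_covLapF_ge_plaq`,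
`posDef_covLapF_of_plaq`, `l2_opNorm_covLapF_inv_le_of_plaq`, `unitaryIso`), Ϳ-c (`re_inner_plaq_unit`, `plaqGap_pos_of_lt_one`), Ͱ-a (`covLapF`), Ͱ-b (`fib`), Ͱ-d (`mem_unitaryGroup_unit_iff`), Ͻ-q
(`kingPlaq`), Mathlib (`Complex.norm_mul_cos_arg`, `Complex.abs_arg_le_pi`, `Real.cos_le_cos_of_nonneg_of_le_pi`).  Dedup (rg at filing): basename 0 files; needles
`re_inner_le_of_sub_bounded_below|re_quadForm_covLapF_ge_of_holonomy_gap|re_le_cos_of_abs_arg_ge|re_quadForm_covLapF_ge_of_plaq_angle|curvatureMass_mono` 0 tree files.  Locators: [DodziukMathai2006] §1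
Cor 1.3; [Balaban1985BackgroundPropagators] (3.23) p.394, (3.39) p.397; [King1986] (2.12) p.653, (4.4) p.670.  0 `sorry`, 0 `def`.
-/

noncomputable section
open scoped BigOperators ComplexConjugate ComplexOrder InnerProductSpace
open Finset Matrix WithLp

namespace Summit.QuantumFields.YangMills.BalabanUVNodes.N15KingModelRung.Curvature

open Literature.MathematicalPhysics.QuantumFieldTheory.Balaban1983to89.B5Prop11Plancherel (Tor unitVec)
open Summit.QuantumFields.YangMills.BalabanUVNodes.N15KingModelRung.Covariant (covLapF fib isHermitian_covLapF mem_unitaryGroup_unit_iff)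
open Summit.QuantumFields.YangMills.BalabanUVNodes.N15KingModelRung.Cover (kingPlaq)

variable {d : ℕ} (K : Fin (d + 1) → ℕ)

/-! ## §1 Holonomy bounded away from `1` ⟹ numerical range in `Re ≤ 1 − s²∕2` -/

section Abstract

variable {𝕜 : Type*} [RCLike 𝕜] {E : Type*} [NormedAddCommGroup E] [InnerProductSpace 𝕜 E]

/-- ★★ **POLARISATION**: for a linear isometry `W` with `s‖u‖ ≤ ‖Wu − u‖` for every `u` (and `s ≥ 0`), `Re⟪u, Wu⟫ ≤ (1 − s²∕2)‖u‖²` — since `‖Wu − u‖² = 2‖u‖² − 2Re⟪u,Wu⟫`.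
For a unitary holonomy whose eigen-angles all satisfy `|θ_j| ≥ θ₀` one may take `s = 2sin(θ₀∕2)`, `1 − s²∕2 = cos θ₀`. [folklore] -/
theorem re_inner_le_of_sub_bounded_below (W : E →ₗᵢ[𝕜] E) {s : ℝ} (hs0 : 0 ≤ s) (hs : ∀ u, s * ‖u‖ ≤ ‖W u - u‖) (u : E) :
    RCLike.re ⟪u, W u⟫_𝕜 ≤ (1 - s ^ 2 / 2) * ‖u‖ ^ 2 := by
  have h1 : ‖W u - u‖ ^ 2 = 2 * ‖u‖ ^ 2 - 2 * RCLike.re ⟪u, W u⟫_𝕜 := by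
    rw [@norm_sub_sq 𝕜, W.norm_map, ← inner_conj_symm, RCLike.conj_re]; ring
  have h2 : (s * ‖u‖) ^ 2 ≤ ‖W u - u‖ ^ 2 := pow_le_pow_left₀ (mul_nonneg hs0 (norm_nonneg _)) (hs u) 2
  rw [h1, mul_pow] at h2
  nlinarith

/-- `1 − (2sin(θ∕2))²∕2 = cos θ` (so `s = 2sin(θ₀∕2)` corresponds to `γ = cos θ₀`). [folklore] -/
theorem one_sub_sq_half_eq_cos (θ : ℝ) : 1 - (2 * Real.sin (θ / 2)) ^ 2 / 2 = Real.cos θ := by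
  have h : Real.cos (θ / 2) ^ 2 = 1 / 2 + Real.cos θ / 2 := by rw [Real.cos_sq (θ / 2), show 2 * (θ / 2) = θ by ring]
  have hs : Real.sin (θ / 2) ^ 2 = 1 - Real.cos (θ / 2) ^ 2 := by rw [Real.sin_sq]
  rw [mul_pow, hs, h]; ring

/-- `0 < s ⟹ λ(1 − s²∕2) > 0`. [folklore] -/
theorem plaqGap_one_sub_sq_half_pos {s : ℝ} (hs : 0 < s) : 0 < plaqGap (1 - s ^ 2 / 2) :=
  plaqGap_pos_of_lt_one (by nlinarith [sq_pos_of_pos hs])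

end Abstract

/-! ## §2 Non-abelian fields with holonomies bounded away from `1` -/

section NonAbelian

variable [hK : ∀ μ, NeZero (K μ)]
variable {𝕜 : Type*} [RCLike 𝕜] {n : Type*} [Fintype n] [DecidableEq n] {c : ℝ}

omit hK in
/-- The hypothesis transfer: `s‖u‖ ≤ ‖(P−1)u‖` (unitary `P`) ⟹ `Re⟪u, Pu⟫ ≤ (1 − s²∕2)‖u‖²`. [folklore] -/
theorem re_inner_toEuclideanLin_le_of_gap {P : Matrix n n 𝕜} (hP : P ∈ Matrix.unitaryGroup n 𝕜) {s : ℝ} (hs0 : 0 ≤ s)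
    (hs : ∀ u : EuclideanSpace 𝕜 n, s * ‖u‖ ≤ ‖Matrix.toEuclideanLin P u - u‖) (u : EuclideanSpace 𝕜 n) :
    RCLike.re ⟪u, Matrix.toEuclideanLin P u⟫_𝕜 ≤ (1 - s ^ 2 / 2) * ‖u‖ ^ 2 :=
  re_inner_le_of_sub_bounded_below (unitaryIso hP) hs0 (fun u => by rw [unitaryIso_apply]; exact hs u) u

omit hK in
/-- The plaquette holonomy of a unitary field is unitary. [folklore] -/
theorem kingPlaq_mem_unitaryGroup {U : Tor K × Fin (d + 1) → Matrix n n 𝕜} (hU : ∀ b, U b ∈ Matrix.unitaryGroup n 𝕜) (x : Tor K) (μ ν : Fin (d + 1)) :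
    kingPlaq K U x μ ν ∈ Matrix.unitaryGroup n 𝕜 := by
  unfold kingPlaq
  have h1 : (U (x + unitVec K ν, μ))ᴴ ∈ Matrix.unitaryGroup n 𝕜 := by simpa only [star_eq_conjTranspose] using Unitary.star_mem (hU _)
  have h2 : (U (x, ν))ᴴ ∈ Matrix.unitaryGroup n 𝕜 := by simpa only [star_eq_conjTranspose] using Unitary.star_mem (hU _)
  exact Submonoid.mul_mem _ (Submonoid.mul_mem _ (Submonoid.mul_mem _ (hU _) (hU _)) h1) h2

/-- ★★★ **CURVATURE BOUNDED BELOW (NON-ABELIAN) ⟹ MASS**: for a unitary link field on any fibre `𝕜ⁿ`, `ν₀ ≠ ν₁`, `c ≥ 0`, `s ≥ 0`: if every `(ν₀,ν₁)`-plaquette holonomy satisfies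
`s‖u‖ ≤ ‖(P_U(x,ν₀,ν₁) − 1)u‖` for all `u` (uniformly NOT close to the identity — for normal `P`, all eigen-angles `≥ 2arcsin(s∕2)`), then
`(m² + 2c·λ(1 − s²∕2))·Σ_x‖v_x‖² ≤ Re⟨v, (−cΔ_U+m²)v⟩`. [cite: DodziukMathai2006, Cor 1.3 §1; Balaban1985BackgroundPropagators, (3.23) p.394; King1986, (2.12) p.653, (4.4) p.670] -/
theorem re_quadForm_covLapF_ge_of_holonomy_gap (hc : 0 ≤ c) (m2 : ℝ) {U : Tor K × Fin (d + 1) → Matrix n n 𝕜} (hU : ∀ b, U b ∈ Matrix.unitaryGroup n 𝕜) {ν₀ ν₁ : Fin (d + 1)}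
    (hν : ν₀ ≠ ν₁) {s : ℝ} (hs0 : 0 ≤ s) (hs : ∀ x, ∀ u : EuclideanSpace 𝕜 n, s * ‖u‖ ≤ ‖Matrix.toEuclideanLin (kingPlaq K U x ν₀ ν₁) u - u‖) (v : Tor K × n → 𝕜) :
    (m2 + 2 * c * plaqGap (1 - s ^ 2 / 2)) * ∑ x, ‖fib K v x‖ ^ 2 ≤ RCLike.re (star v ⬝ᵥ (covLapF K c m2 U *ᵥ v)) :=
  re_quadForm_covLapF_ge_plaq K hc m2 hU hν (fun x u => re_inner_toEuclideanLin_le_of_gap (kingPlaq_mem_unitaryGroup K hU x ν₀ ν₁) hs0 (hs x) u) v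

open scoped Matrix.Norms.L2Operator in
/-- ★★ … and `‖(−cΔ_U+m²)⁻¹‖_{ℓ²→ℓ²} ≤ (m² + 2c·λ(1 − s²∕2))⁻¹` whenever the right side is positive (e.g. `m² = 0`, `c > 0`, `s > 0`): EVERY uniformly curved non-abelian field gives King's
massless covariant Laplacian a volume-independent mass. [cite: DodziukMathai2006, Cor 1.3 §1; Balaban1985BackgroundPropagators, (3.39) p.397] -/
theorem l2_opNorm_covLapF_inv_le_of_holonomy_gap (hc : 0 ≤ c) {m2 : ℝ} {U : Tor K × Fin (d + 1) → Matrix n n 𝕜} (hU : ∀ b, U b ∈ Matrix.unitaryGroup n 𝕜) {ν₀ ν₁ : Fin (d + 1)}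
    (hν : ν₀ ≠ ν₁) {s : ℝ} (hs0 : 0 ≤ s) (hs : ∀ x, ∀ u : EuclideanSpace 𝕜 n, s * ‖u‖ ≤ ‖Matrix.toEuclideanLin (kingPlaq K U x ν₀ ν₁) u - u‖)
    (hpos : 0 < m2 + 2 * c * plaqGap (1 - s ^ 2 / 2)) :
    ‖(covLapF K c m2 U)⁻¹‖ ≤ (m2 + 2 * c * plaqGap (1 - s ^ 2 / 2))⁻¹ :=
  l2_opNorm_covLapF_inv_le_of_plaq K hc hU hν (fun x u => re_inner_toEuclideanLin_le_of_gap (kingPlaq_mem_unitaryGroup K hU x ν₀ ν₁) hs0 (hs x) u) hpos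

end NonAbelian

/-! ## §3 `U(1)`: inhomogeneous flux with angles bounded below in modulus -/

section Angle

variable [hK : ∀ μ, NeZero (K μ)] {c : ℝ}

omit hK in
/-- ★ For a unit complex number, `θ₀ ≤ |arg z|` with `0 ≤ θ₀` ⟹ `Re z ≤ cos θ₀` (`Re z = cos(arg z)`, `cos` even and antitone on `[0, π]`, `|arg z| ≤ π`). [folklore] -/
theorem re_le_cos_of_abs_arg_ge {z : ℂ} (hz : ‖z‖ = 1) {θ₀ : ℝ} (h0 : 0 ≤ θ₀) (h : θ₀ ≤ |Complex.arg z|) : z.re ≤ Real.cos θ₀ := by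
  have hre : z.re = Real.cos (Complex.arg z) := by rw [← Complex.norm_mul_cos_arg z, hz, one_mul]
  rw [hre, ← Real.cos_abs (Complex.arg z)]
  exact Real.cos_le_cos_of_nonneg_of_le_pi h0 (Complex.abs_arg_le_pi z) h

omit hK in
/-- The `1 × 1` plaquette of a `U(1)` field has modulus one. [folklore] -/
theorem norm_kingPlaq_unit {U : Tor K × Fin (d + 1) → Matrix Unit Unit ℂ} (hU : ∀ b, U b ∈ Matrix.unitaryGroup Unit ℂ) (x : Tor K) (μ ν : Fin (d + 1)) :
    ‖kingPlaq K U x μ ν () ()‖ = 1 :=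
  (mem_unitaryGroup_unit_iff _).mp (kingPlaq_mem_unitaryGroup K hU x μ ν)

/-- ★★★ **INHOMOGENEOUS FLUX BOUNDED BELOW ⟹ MASS** (`U(1)`, `ν₀ ≠ ν₁`, `c ≥ 0`, `0 ≤ θ₀ ≤ π`): if the `(ν₀,ν₁)`-plaquette ANGLES satisfy `θ₀ ≤ |arg P_U(x,ν₀,ν₁)|` at EVERY site (any
sign, any spatial dependence), then `(m² + 2c(2 − 2cos(θ₀∕4)))·Σ_x|v_x|² ≤ Re⟨v, (−cΔ_U+m²)v⟩` — Ϳ-c's constant-flux mass needs only a site-wise lower bound on the curvature modulus.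
[cite: DodziukMathai2006, Cor 1.3 §1; King1986, (2.12) p.653, (4.4) p.670; Balaban1985BackgroundPropagators, (3.23) p.394] -/
theorem re_quadForm_covLapF_ge_of_plaq_angle (hc : 0 ≤ c) (m2 : ℝ) {U : Tor K × Fin (d + 1) → Matrix Unit Unit ℂ} (hU : ∀ b, U b ∈ Matrix.unitaryGroup Unit ℂ) {ν₀ ν₁ : Fin (d + 1)}
    (hν : ν₀ ≠ ν₁) {θ₀ : ℝ} (h0 : 0 ≤ θ₀) (hπ : θ₀ ≤ Real.pi) (hθ : ∀ x, θ₀ ≤ |Complex.arg (kingPlaq K U x ν₀ ν₁ () ())|) (v : Tor K × Unit → ℂ) :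
    (m2 + 2 * c * (2 - 2 * Real.cos (θ₀ / 4))) * ∑ x, ‖fib K v x‖ ^ 2 ≤ (star v ⬝ᵥ (covLapF K c m2 U *ᵥ v)).re := by
  have h := re_quadForm_covLapF_ge_plaq_unit K hc m2 hU hν (γ := Real.cos θ₀) (fun x => re_le_cos_of_abs_arg_ge (norm_kingPlaq_unit K hU x ν₀ ν₁) h0 (hθ x)) v
  rwa [plaqGap_cos (abs_le.mpr ⟨by linarith, hπ⟩)] at h

/-- ★★ **THE MASSLESS OPERATOR IS POSITIVE DEFINITE** under a positive curvature floor `0 < θ₀ ≤ π` (`c > 0`). [cite: DodziukMathai2006, Cor 1.3 §1; Balaban1985BackgroundPropagators, (3.23) p.394] -/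
theorem posDef_covLapF_massless_of_plaq_angle (hc : 0 < c) {U : Tor K × Fin (d + 1) → Matrix Unit Unit ℂ} (hU : ∀ b, U b ∈ Matrix.unitaryGroup Unit ℂ) {ν₀ ν₁ : Fin (d + 1)}
    (hν : ν₀ ≠ ν₁) {θ₀ : ℝ} (h0 : 0 < θ₀) (hπ : θ₀ ≤ Real.pi) (hθ : ∀ x, θ₀ ≤ |Complex.arg (kingPlaq K U x ν₀ ν₁ () ())|) : (covLapF K c 0 U).PosDef := by
  refine posDef_covLapF_of_plaq K hc.le hU hν (γ := Real.cos θ₀)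
    (fun x u => by rw [re_inner_plaq_unit]; exact mul_le_mul_of_nonneg_right (re_le_cos_of_abs_arg_ge (norm_kingPlaq_unit K hU x ν₀ ν₁) h0.le (hθ x)) (sq_nonneg _)) ?_
  rw [zero_add]
  refine mul_pos (mul_pos two_pos hc) (plaqGap_pos_of_lt_one ?_)
  calc Real.cos θ₀ < Real.cos 0 := Real.cos_lt_cos_of_nonneg_of_le_pi le_rfl hπ h0
    _ = 1 := Real.cos_zero

open scoped Matrix.Norms.L2Operator in
/-- ★★ `‖(−cΔ_U+m²)⁻¹‖ ≤ (m² + 2c(2−2cos(θ₀∕4)))⁻¹` under the curvature floor, whenever the right side is positive. [cite: DodziukMathai2006, Cor 1.3 §1; Balaban1985BackgroundPropagators, (3.39) p.397] -/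
theorem l2_opNorm_covLapF_inv_le_of_plaq_angle (hc : 0 ≤ c) {m2 : ℝ} {U : Tor K × Fin (d + 1) → Matrix Unit Unit ℂ} (hU : ∀ b, U b ∈ Matrix.unitaryGroup Unit ℂ) {ν₀ ν₁ : Fin (d + 1)}
    (hν : ν₀ ≠ ν₁) {θ₀ : ℝ} (h0 : 0 ≤ θ₀) (hπ : θ₀ ≤ Real.pi) (hθ : ∀ x, θ₀ ≤ |Complex.arg (kingPlaq K U x ν₀ ν₁ () ())|)
    (hpos : 0 < m2 + 2 * c * (2 - 2 * Real.cos (θ₀ / 4))) : ‖(covLapF K c m2 U)⁻¹‖ ≤ (m2 + 2 * c * (2 - 2 * Real.cos (θ₀ / 4)))⁻¹ := by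
  have hθπ : |θ₀| ≤ Real.pi := abs_le.mpr ⟨by linarith, hπ⟩
  have hpos' : 0 < m2 + 2 * c * plaqGap (Real.cos θ₀) := by rwa [plaqGap_cos hθπ]
  have h := l2_opNorm_covLapF_inv_le_of_plaq K hc (m2 := m2) hU hν (γ := Real.cos θ₀)
    (fun x u => by rw [re_inner_plaq_unit]; exact mul_le_mul_of_nonneg_right (re_le_cos_of_abs_arg_ge (norm_kingPlaq_unit K hU x ν₀ ν₁) h0 (hθ x)) (sq_nonneg _)) hpos'
  rwa [plaqGap_cos hθπ] at h

end Angle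

/-! ## §4 Monotonicity of the curvature mass -/

section Mono

/-- MORE CURVATURE, MORE MASS: `θ ↦ 2 − 2cos(θ∕4)` is monotone on `[0, π]`. [folklore] -/
theorem curvatureMass_mono {θ₁ θ₂ : ℝ} (h1 : 0 ≤ θ₁) (h12 : θ₁ ≤ θ₂) (h2 : θ₂ ≤ Real.pi) : 2 - 2 * Real.cos (θ₁ / 4) ≤ 2 - 2 * Real.cos (θ₂ / 4) := by
  have hcos : Real.cos (θ₂ / 4) ≤ Real.cos (θ₁ / 4) :=
    Real.cos_le_cos_of_nonneg_of_le_pi (by linarith) (by linarith [Real.pi_pos]) (by linarith)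
  linarith

/-- … and saturates at the π-flux value `2 − 2cos(π∕4) = 2 − √2 = λ(−1)` of Ϳ-d. [folklore] -/
theorem curvatureMass_le_pi {θ : ℝ} (h0 : 0 ≤ θ) (hπ : θ ≤ Real.pi) : 2 - 2 * Real.cos (θ / 4) ≤ 2 - Real.sqrt 2 := by
  have h := curvatureMass_mono h0 hπ le_rfl
  rw [Real.cos_pi_div_four] at h
  linarith

end Mono

end Summit.QuantumFields.YangMills.BalabanUVNodes.N15KingModelRung.Curvature

end
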